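import Summits.BirchSwinnertonDyer.BirchSwinnertonDyer.Theses.VerticalContact
import Summits.BirchSwinnertonDyer.BirchSwinnertonDyer.Theses.ToricShedding
import Summits.BirchSwinnertonDyer.BirchSwinnertonDyer.Theses.SelmerRank
import Summits.BirchSwinnertonDyer.BirchSwinnertonDyer.Theorems.TangentConeSelmerRankSmallImageReduction
import HarnessLib

/-!
# Line `sector-split` for crux `PGSelmerBSD` (stmt-BirchSwinnertonDyer-17810), route VerticalContact

Crux (fixed, by name): `VerticalContact.PGSelmerBSD` —
`∀ W elliptic, globally minimal, (¬ ∃ q, multiplicative at q) → ∃ p, corank_{ℤ_p} Sel_{p^∞}(W/ℚ) = r_an(W)`.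

Skeleton (crux-strategist, 2026-08-17): the potentially-good sector splits along the image of `ρ̄_{E,p}`
into THREE REGISTERED STUBS, each of which IS, letter for letter, an item the fleet already staffs on a
sibling route (proved identifications `stub_…_iff` below), and a sorry-free composition `PGSelmerBSD_of`
concluding the crux BY NAME (hypotheses `Statement.stub_*` by name):

* `stub_ubPotentiallyGood`  = route ToricShedding's `UBPotentiallyGood` (stmt-BirchSwinnertonDyer-15878):
  sector upper bound `corank_p ≤ r_an` at every big-image good ordinary `p ≥ 5` (open from corank 4;
  mechanisms: Heegner-setting Kolyvagin shedding, or this route's vertical contact order over a real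
  quadratic field — crux idea `real-quadratic-contact`);
* `stub_selmerRankLB`       = this route's (and SelmerRank's …) `SelmerRankLB` (stmt-BirchSwinnertonDyer-0131):
  `r_an ≤ corank_p` at every such `p` (theorem for `r_an ≤ 3`, open from 4);
* `stub_selmerRankCM`       = route SelmerRank's `SelmerRankCM` (stmt-BirchSwinnertonDyer-18086): CM curves at
  every good ordinary `p ≥ 5` (open from `min(corank_p, r_an) ≥ 2`).

Composition: `by_cases W.HasCM`; CM — the proved prime supply `exists_good_ordinary_prime_holds` and stub 3;
non-CM — Serre's open image theorem in the proved form `exists_goodOrdinary_surjective_of_not_hasCM`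
(Theorems/TangentConeSelmerRankSmallImageReduction) gives a big-image good ordinary `p ≥ 5`, where stubs 1
and 2 are the two inequalities. A LEAD ON THIS LINE WAVES NO STUB-WORKERS: every stub is an item served
elsewhere; the line's only deliverable is the Theorems form of `PGSelmerBSD_of` (evidence `Split.lean` on
the item, Theorems-ready) and the route-level `--split` of the census (children.json on the item).
Disproof used: none exists for this crux (no cdisprove has run; `ledger negatives`: 1 unrelated entry).
-/

set_option linter.dupNamespace false

namespace Summit.BirchSwinnertonDyer.BirchSwinnertonDyer.Cruxes.PGSelmerBSD.SectorSplit

open Summit.BirchSwinnertonDyer.BirchSwinnertonDyer.Theses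
open Summit.BirchSwinnertonDyer.BirchSwinnertonDyer.Theorems
open Literature.NumberTheory.EllipticCurves

/-- STUB 1 (= ToricShedding.UBPotentiallyGood, stmt-15878): the sector upper bound at every big-image good
ordinary prime `p ≥ 5`. Open from corank 4. -/
theorem stub_ubPotentiallyGood :
    ∀ (W : WeierstrassCurve ℚ) [W.IsElliptic] [W.IsGloballyMinimal],
      (¬ ∃ (q : ℕ) (_ : Fact q.Prime), W.HasMultiplicativeReductionAtPrime q) →
      ∀ (p : ℕ) [Fact p.Prime], 5 ≤ p → W.HasGoodReductionAtPrime p → ¬ (p : ℤ) ∣ W.frobeniusTrace p →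
        W.HasSurjectiveModNGaloisRep p → W.selmerCorank p ≤ W.analyticRank := by
  sorry

/-- STUB 2 (= VerticalContact.SelmerRankLB = SelmerRank.SelmerRankLB, stmt-0131): the lower bound at every
big-image good ordinary prime `p ≥ 5`. Theorem for `r_an ≤ 3`, open from `r_an = 4`. -/
theorem stub_selmerRankLB :
    ∀ (W : WeierstrassCurve ℚ) [W.IsElliptic] [W.IsGloballyMinimal] (p : ℕ) [Fact p.Prime],
      5 ≤ p → W.HasGoodReductionAtPrime p → ¬ (p : ℤ) ∣ W.frobeniusTrace p →
        W.HasSurjectiveModNGaloisRep p → W.analyticRank ≤ W.selmerCorank p := by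
  sorry

/-- STUB 3 (= SelmerRank.SelmerRankCM, stmt-18086): Selmer-rank BSD for CM curves at every good ordinary
`p ≥ 5`. Open from `min(corank_p, r_an) ≥ 2`. -/
theorem stub_selmerRankCM :
    ∀ (W : WeierstrassCurve ℚ) [W.IsElliptic] [W.IsGloballyMinimal] (p : ℕ) [Fact p.Prime],
      5 ≤ p → W.HasGoodReductionAtPrime p → ¬ (p : ℤ) ∣ W.frobeniusTrace p → W.HasCM →
        W.selmerCorank p = W.analyticRank := by
  sorry

namespace Statement

/-- Statement of `stub_ubPotentiallyGood`. -/
abbrev stub_ubPotentiallyGood : Prop := type_of% @SectorSplit.stub_ubPotentiallyGood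
/-- Statement of `stub_selmerRankLB`. -/
abbrev stub_selmerRankLB : Prop := type_of% @SectorSplit.stub_selmerRankLB
/-- Statement of `stub_selmerRankCM`. -/
abbrev stub_selmerRankCM : Prop := type_of% @SectorSplit.stub_selmerRankCM

end Statement

/-! ### The crux from the stubs (kernel-checked composition, no `sorry`) -/

/-- COMPOSITION (sorry-free): the three stub statements give the crux BY NAME. Case split on
`W.HasCM`; primes from `exists_good_ordinary_prime_holds` (CM) and
`exists_goodOrdinary_surjective_of_not_hasCM` (Serre, non-CM), both proved in the tree. [folklore] -/
theorem PGSelmerBSD_of (hUB : Statement.stub_ubPotentiallyGood) (hLB : Statement.stub_selmerRankLB)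
    (hCM : Statement.stub_selmerRankCM) :
    Summit.BirchSwinnertonDyer.BirchSwinnertonDyer.Theses.VerticalContact.PGSelmerBSD := by
  intro W _ _ hpg
  by_cases hW : W.HasCM
  · obtain ⟨p, hp, h5, hgood, hord⟩ := WeierstrassCurve.exists_good_ordinary_prime_holds W
    exact ⟨p, hp, hCM W p h5 hgood hord hW⟩
  · obtain ⟨p, hp, h5, hgood, hord, hsurj⟩ := exists_goodOrdinary_surjective_of_not_hasCM W hW
    exact ⟨p, hp, le_antisymm (hUB W hpg p h5 hgood hord hsurj) (hLB W p h5 hgood hord hsurj)⟩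

/-- The crux along this line, MODULO exactly the three registered stubs (depends on `sorryAx` only
through `stub_*`). [folklore] -/
theorem PGSelmerBSD_proof :
    Summit.BirchSwinnertonDyer.BirchSwinnertonDyer.Theses.VerticalContact.PGSelmerBSD :=
  PGSelmerBSD_of stub_ubPotentiallyGood stub_selmerRankLB stub_selmerRankCM

/-! ### Proved identifications: every stub IS an existing item (no stub is new work) -/

/-- Stub 1 is route ToricShedding's item `UBPotentiallyGood` (stmt-15878), the same term. [folklore] -/
theorem stub_ubPotentiallyGood_iff :
    Statement.stub_ubPotentiallyGood ↔ ToricShedding.UBPotentiallyGood := Iff.rfl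

/-- Stub 2 is this route's item `SelmerRankLB` (stmt-0131). [folklore] -/
theorem stub_selmerRankLB_iff :
    Statement.stub_selmerRankLB ↔ VerticalContact.SelmerRankLB := Iff.rfl

/-- … and route SelmerRank's `SelmerRankLB` is the same term. [folklore] -/
theorem selmerRankLB_verticalContact_iff_selmerRank :
    VerticalContact.SelmerRankLB ↔ SelmerRank.SelmerRankLB := Iff.rfl

/-- Stub 3 is route SelmerRank's item `SelmerRankCM` (stmt-18086), the same term. [folklore] -/
theorem stub_selmerRankCM_iff :
    Statement.stub_selmerRankCM ↔ SelmerRank.SelmerRankCM := Iff.rfl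

/-- By-name form of the composition over the sibling items (= evidence `Split.lean`,
`pgSelmerBSD_of_items`). [folklore] -/
theorem pgSelmerBSD_of_items :
    ToricShedding.UBPotentiallyGood → VerticalContact.SelmerRankLB → SelmerRank.SelmerRankCM →
      VerticalContact.PGSelmerBSD :=
  fun hUB hLB hCM => PGSelmerBSD_of hUB hLB hCM

/-! ### Anchor (proved special case): the crux in analytic rank ≤ 1, at ANY prime, from GZK -/

/-- The `r_an ≤ 1` slice of the crux is Gross–Zagier–Kolyvagin read on the Selmer side (tree fact
`rank_eq_analyticRank_of_analyticRank_le_one` as hypothesis, via the proved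
`selmerCorank_eq_analyticRank_of_analyticRank_le_one`), at every prime; the sector hypothesis is not used.
[cite: GrossZagier1986, Thm I.6.3; Kolyvagin1990, Thm A] -/
theorem pgSelmerBSD_of_analyticRank_le_one
    (hGZK : rank_eq_analyticRank_of_analyticRank_le_one)
    (W : WeierstrassCurve ℚ) [W.IsElliptic] [W.IsGloballyMinimal] (h : W.analyticRank ≤ 1) :
    ∃ (p : ℕ) (_ : Fact p.Prime), W.selmerCorank p = W.analyticRank :=
  ⟨2, ⟨Nat.prime_two⟩, selmerCorank_eq_analyticRank_of_analyticRank_le_one hGZK W 2 h⟩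

end Summit.BirchSwinnertonDyer.BirchSwinnertonDyer.Cruxes.PGSelmerBSD.SectorSplit
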